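import Mathlib
import HarnessLib
import Literature.Analysis.FluidPDE.OctahedralSymmetry
import Literature.MathematicalPhysics.QuantumLattice.EuclideanAction
import Summits.QuantumFields.YangMills.Theses.PencilRigidity
import Summits.QuantumFields.YangMills.Theorems.PencilRigidityShellRigidityExponentReduction
import Summits.QuantumFields.YangMills.Theorems.PencilRigidityShellRigidityAxisLaplace
import Summits.QuantumFields.YangMills.Theorems.PencilRigidityShellRigidityRadialLift
import Summits.QuantumFields.YangMills.Theorems.PencilRigidityShellRigidityPlanarDiscSections
import Summits.QuantumFields.YangMills.Theorems.PencilRigidityShellRigidityConeOfDiscSections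

/-!
# Line `transverse-smearing-planar-threshold` — LEAD skeleton (reshaped v3) for crux
# `PencilRigidity.ShellRigidity` (stmt-QuantumFields-11685, route-QuantumFields-PencilRigidity)

Lead prover `prover-line-stmt-QuantumFields-11685-0`, 2026-08-16.

State after wave 1: stubs 1, 2, 4, 5, 6 of v2 LANDED (`stub_exponentReduction` p74993,
`stub_axisLaplace` p75550, `stub_radialLift` p74318, `stub_planarDiscSections` p74219,
`stub_coneOfDiscSections` p76937 — imported above, their sorried copies removed); `stub_smearTransport`
proved by its worker but re-registered in `let`-free form (a `let` in a registered signature is cut at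
`:=` by the registry); the lead's stub 7 `stub_planarAngularRigidity` is SPLIT (v3) into two registered
sub-lemmas — `stub_angularChart` (the complexified-angle chart of a cone-supported Laplace–Fourier
measure: holomorphy on a rectangle, the cone bound, real values, evenness, positivity on the imaginary
axis) and `stub_fourierVanish` (a continuous `π/2`-periodic function with such charts of exponential type
`σ < 8` is a trigonometric polynomial of degree `≤ 1` in `e^{4iα}`) — plus its assembly (identity theorem
on convex rectangles, positivity in the axis and the diagonal chart), landed as the file proving
`stub_planarAngularRigidity`; and the planar engine assembly (v2 glue `planar_radial`: Stubs 5, 6, 7 ⇒ a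
planar kernel represented in both charts is radial) is registered as `stub_planarRadial` so that it lands
as its own file and the closing file stays small. This skeleton = the closing file modulo the registered
stubs: `W(B₄)` bookkeeping through the tree's hyperoctahedral toolkit
(`Literature.Analysis.FluidPDE.IsSignedPermIsometry`, definitionally the crux's hypothesis), the
light-cone involution `L₄ (x₀,x₁,x₂,x₃) = ((x₀+x₁)/√2, (x₀-x₁)/√2, x₂, x₃)` written out (no `def`), and
`ShellRigidity_proof : PencilRigidity.ShellRigidity` BY NAME.

Registered stubs (v3): `stub_smearTransport`, `stub_planarRadial`, `stub_planarAngularRigidity`,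
`stub_angularChart`, `stub_fourierVanish` (5 ≤ 7).

Disproof used: `Cruxes/ShellRigidity/Disproof.lean` (cdisprove g2, commit de3ee3809364) — its landed
`Negative/PlanarThresholdSharp.lean` (p76045: `cos 8φ / r⁸` with explicit cone-boundary measures) shows
`stub_planarAngularRigidity` is SHARP at `σ = 8`; our `σ < 8` is exactly the typed threshold, so nothing
to change; `Negative/LoadBearing.lean` (`shellRigidity_false_without_B4`, `_without_diag`) — both
hypotheses are consumed here (`W(B₄)` everywhere; the diagonal clause in `kernel45_axisRP`). The drefute
survey (v2, 02:01Z) reports 0 stub-false / 0 stub-misstated / 7 survived.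
-/

noncomputable section

namespace Summit.QuantumFields.YangMills.Cruxes.ShellRigidity.TransverseSmearingPlanarThreshold

open MeasureTheory Complex
open scoped BigOperators InnerProductSpace
open Literature.MathematicalPhysics.QuantumLattice Literature.Analysis.FluidPDE

/-! ## Registered stubs (the only `sorry`s; statements over Mathlib + tree only) -/

/-- **Stub · transverse smearing transports everything to the plane** (L; proved by stub-worker
a69cd1db, landing as `PencilRigidityShellRigiditySmearTransport.lean`). `F` is passed as a variable with
its defining equation `hF` (no `let` in registered signatures). For `K` continuous off `0` with
`|K x| ≤ C(1 + ‖x‖^(η-10))`, `0 < η < 8`, invariant under the swap of coordinates `0,1`, under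
`x₁ ↦ -x₁` and `x₀ ↦ -x₀`, with axis Laplace–Fourier representations, and `h ∈ C_c(ℝ²)`: the smearing
`F(t,s) = ∫∫ h y h y' K(t,s,y-y') dy dy'` is continuous off `0`, of order `8 - η`, `D₄`-symmetric, and
represented (`ν_ε = |ĥ ∘ p_⊥|² · μ_ε`, Fubini). -/
theorem stub_smearTransport (K : EuclideanSpace ℝ (Fin 4) → ℝ) (η : ℝ) (hη : 0 < η) (hη8 : η < 8)
    (hc : ContinuousOn K {x | x ≠ 0})
    (hb : ∃ C : ℝ, ∀ x : EuclideanSpace ℝ (Fin 4), x ≠ 0 → |K x| ≤ C * (1 + ‖x‖ ^ (η - 10)))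
    (hswap : ∀ x y : EuclideanSpace ℝ (Fin 4), y 0 = x 1 → y 1 = x 0 → y 2 = x 2 → y 3 = x 3 → K y = K x)
    (hneg1 : ∀ x y : EuclideanSpace ℝ (Fin 4), y 0 = x 0 → y 1 = -x 1 → y 2 = x 2 → y 3 = x 3 → K y = K x)
    (hθ : ∀ x y : EuclideanSpace ℝ (Fin 4), y 0 = -x 0 → y 1 = x 1 → y 2 = x 2 → y 3 = x 3 → K y = K x)
    (hrep : ∀ ε : ℝ, 0 < ε → ∃ μ : Measure (EuclideanSpace ℝ (Fin 4)), IsFiniteMeasure μ ∧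
      μ {p | p 0 < 0} = 0 ∧
      ∀ t : ℝ, 0 ≤ t → ∀ a : EuclideanSpace ℝ (Fin 4), a 0 = 0 →
        ((K (EuclideanSpace.single 0 (ε + t) + a) : ℝ) : ℂ) =
          ∫ p, cexp (((-(t * p 0) : ℝ) : ℂ) + ((⟪a, p⟫_ℝ : ℝ) : ℂ) * I) ∂μ)
    (h : ℝ × ℝ → ℝ) (hh : Continuous h) (hhs : HasCompactSupport h) (F : ℝ × ℝ → ℝ)
    (hF : ∀ x : ℝ × ℝ, F x = ∫ y : ℝ × ℝ, ∫ y' : ℝ × ℝ,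
      h y * h y' * K (WithLp.toLp 2 ![x.1, x.2, (y - y').1, (y - y').2])) :
    ContinuousOn F {x | x ≠ 0} ∧
    (∃ C : ℝ, ∀ x : ℝ × ℝ, x ≠ 0 → |F x| ≤ C * (1 + (x.1 ^ 2 + x.2 ^ 2) ^ (-((8 - η) / 2)))) ∧
    (∀ t s : ℝ, F (t, s) = F (s, t) ∧ F (t, s) = F (t, -s) ∧ F (t, s) = F (-t, s)) ∧
    (∀ ε : ℝ, 0 < ε → ∃ ν : Measure (EuclideanSpace ℝ (Fin 4)), IsFiniteMeasure ν ∧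
      ν {p | p 0 < 0} = 0 ∧
      ∀ t : ℝ, 0 ≤ t → ∀ b : ℝ, ((F (ε + t, b) : ℝ) : ℂ) =
        ∫ p, cexp ((((-(t * p 0) : ℝ)) : ℂ) + ((b * p 1 : ℝ) : ℂ) * I) ∂ν) := by
  sorry

/-- **Stub · the complexified-angle chart of a cone-supported Laplace–Fourier measure** (M/L; first
half of the lead's stub 7). For a finite measure `μ` on energy–momentum space carried by the light cone
`{p₀ ≥ |p₁|}`, radius `r > 0`, shift `ε > 0` and depth `Ψ > 0` with `ε ≤ r cos(3π/8) e^{-Ψ}`, the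
symmetrised chart `H(w) = ∫ e^{-(r cos w - ε) p₀} cos(r sin w · p₁) dμ` is: holomorphic on the rectangle
`{|Re w| < 3π/8, |Im w| < Ψ}` (dominated holomorphic parameter integral: on the cone the integrand has
modulus `≤ e^{-(r cos(Re w) e^{-|Im w|} - ε) p₀} ≤ 1`, `cosh ψ - |sinh ψ| = e^{-|ψ|}`); bounded there by the
Laplace transform of `μ` at time `m_w - ε`, `m_w = r cos(Re w) e^{-|Im w|}` (written in the shape of the
axis representations, `b = 0`); equal at real `α` to the average of the two Laplace–Fourier integrals at
`(t, b) = (r cos α - ε, ± r sin α)` (`cos θ = (e^{iθ} + e^{-iθ})/2`); even; and REAL NONNEGATIVE on the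
imaginary axis (`cos(i x) = cosh x > 0`). -/
theorem stub_angularChart (μ : Measure (EuclideanSpace ℝ (Fin 4))) [IsFiniteMeasure μ]
    (hE : μ {p | p 0 < 0} = 0) (hcone : μ {p | p 0 < |p 1|} = 0)
    (r ε Ψ : ℝ) (hr : 0 < r) (hε : 0 < ε) (hΨ : 0 < Ψ)
    (hεΨ : ε ≤ r * Real.cos (3 * Real.pi / 8) * Real.exp (-Ψ))
    (H : ℂ → ℂ)
    (hH : ∀ w : ℂ, H w = ∫ p, cexp (-(((r : ℂ) * Complex.cos w - (ε : ℂ)) * ((p 0 : ℝ) : ℂ))) *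
      Complex.cos ((r : ℂ) * Complex.sin w * ((p 1 : ℝ) : ℂ)) ∂μ) :
    DifferentiableOn ℂ H {w : ℂ | |w.re| < 3 * Real.pi / 8 ∧ |w.im| < Ψ} ∧
    (∀ w : ℂ, |w.re| < 3 * Real.pi / 8 → |w.im| < Ψ →
      ‖H w‖ ≤ ‖∫ p, cexp ((((-((r * Real.cos w.re * Real.exp (-|w.im|) - ε) * p 0)) : ℝ) : ℂ) +
        (((0 : ℝ) * p 1 : ℝ) : ℂ) * I) ∂μ‖) ∧
    (∀ α : ℝ, |α| < 3 * Real.pi / 8 →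
      H α = ((∫ p, cexp ((((-((r * Real.cos α - ε) * p 0)) : ℝ) : ℂ) +
                ((r * Real.sin α * p 1 : ℝ) : ℂ) * I) ∂μ) +
             ∫ p, cexp ((((-((r * Real.cos α - ε) * p 0)) : ℝ) : ℂ) +
                ((-(r * Real.sin α) * p 1 : ℝ) : ℂ) * I) ∂μ) / 2) ∧
    (∀ w : ℂ, H (-w) = H w) ∧
    (∀ χ : ℝ, |χ| < Ψ → (H (χ * I)).im = 0 ∧ 0 ≤ (H (χ * I)).re) := by
  sorry

/-- **Stub · Fourier modes of a `π/2`-periodic function with charts of exponential type `< 8`**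
(M/L; second half of the lead's stub 7, one complex variable). `g` continuous and `π/2`-periodic; for
every depth `Ψ > 0` a function `h` holomorphic on the rectangle `{|Re w| < 3π/8, |Im w| < Ψ}`, equal to
`g` at its real points, with EQUAL VALUES on the two vertical lines `Re w = ±π/4`, and
`‖h w‖ ≤ A + B e^{σ|Im w|}` with `σ < 8` (`A`, `B` independent of `Ψ`). Then the Fourier coefficients
`ĝ(n) = (2/π) ∫_{-π/4}^{π/4} g e^{-4inα}` vanish for `|n| ≥ 2`: Cauchy on the rectangle
`[-π/4, π/4] × [0, ψ]` (`Complex.integral_boundary_rect_eq_zero_of_differentiableOn`; the vertical sides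
cancel since `e^{-4in(±π/4)} = (-1)^n`) moves the integral to height `ψ`, where it is
`≤ (A + B e^{σ|ψ|}) e^{4nψ} → 0` as `ψ → ∓∞`; and a continuous function on `AddCircle (π/2)` with finitely
many nonzero coefficients is its Fourier polynomial (`hasSum_fourier_series_of_summable`,
`fourierCoeff_eq_intervalIntegral`). -/
theorem stub_fourierVanish (g : ℝ → ℂ) (hg : Continuous g) (hper : Function.Periodic g (Real.pi / 2))
    (σ A B : ℝ) (hσ8 : σ < 8)
    (hcharts : ∀ Ψ : ℝ, 0 < Ψ → ∃ h : ℂ → ℂ,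
      DifferentiableOn ℂ h {w : ℂ | |w.re| < 3 * Real.pi / 8 ∧ |w.im| < Ψ} ∧
      (∀ α : ℝ, |α| < 3 * Real.pi / 8 → h α = g α) ∧
      (∀ y : ℝ, |y| < Ψ → h (((Real.pi / 4 : ℝ) : ℂ) + y * I) = h (((-(Real.pi / 4) : ℝ) : ℂ) + y * I)) ∧
      (∀ w : ℂ, |w.re| < 3 * Real.pi / 8 → |w.im| < Ψ → ‖h w‖ ≤ A + B * Real.exp (σ * |w.im|))) :
    ∃ c₀ c₁ c₂ : ℂ, ∀ x : ℝ,
      g x = c₀ + c₁ * cexp (4 * (x : ℂ) * I) + c₂ * cexp (-(4 * (x : ℂ) * I)) := by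
  sorry

/-- **Stub · angular rigidity below the planar threshold** (L; the lead's stub, now the ASSEMBLY of
`stub_angularChart` and `stub_fourierVanish`). `F` continuous off `0`, of order `0 < σ < 8`,
`D₄`-symmetric, whose shifted restrictions `F(ε + t, b)` (axis chart) and `F((ε+u+v)/√2, (ε+u-v)/√2)`
(diagonal chart) are, for every `ε > 0`, Laplace–Fourier transforms of finite measures carried by the
light cone. For `r > 0` and depth `Ψ` take `ε = r cos(3π/8) e^{-Ψ}` and the two charts `H_A`, `H_D`
(`stub_angularChart`): `H_A = g` and `w ↦ H_D(w + π/4) = g` at real points (`g(α) = F(r cos α, r sin α)`,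
by the representations and `D₄`), `‖H_A‖ ≤ |F(m_w, 0)| ≤ C(1 + (r cos(3π/8))^{-σ} e^{σ|Im w|})`; the identity
theorem on the convex rectangle `{Re w ∈ (-3π/8, π/8)}` glues the charts, and evenness of both gives
`H_A(π/4 + iy) = H_A(-π/4 + iy)`; `stub_fourierVanish` makes `g = c₀ + c₁e^{4iα} + c₂e^{-4iα}`; by the
identity theorem again `c₀ + c₁e^{-4χ} + c₂e^{4χ} = H_A(iχ) ≥ 0` and `c₀ - c₁e^{-4χ} - c₂e^{4χ} = H_D(iχ) ≥ 0`
for all `χ`, whence `c₁ = c₂ = 0` and `g` is constant. Sharp at `σ = 8`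
(`Theorems/ShellRigidity/Negative/PlanarThresholdSharp.lean`). -/
theorem stub_planarAngularRigidity (F : ℝ × ℝ → ℝ) (σ : ℝ) (hσ : 0 < σ) (hσ8 : σ < 8)
    (hc : ContinuousOn F {x | x ≠ 0})
    (hb : ∃ C : ℝ, ∀ x : ℝ × ℝ, x ≠ 0 → |F x| ≤ C * (1 + (x.1 ^ 2 + x.2 ^ 2) ^ (-(σ / 2))))
    (hsym : ∀ t s : ℝ, F (t, s) = F (s, t) ∧ F (t, s) = F (t, -s) ∧ F (t, s) = F (-t, s))
    (hA : ∀ ε : ℝ, 0 < ε → ∃ μ : Measure (EuclideanSpace ℝ (Fin 4)), IsFiniteMeasure μ ∧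
      μ {p | p 0 < 0} = 0 ∧ μ {p | p 0 < |p 1|} = 0 ∧
      ∀ t : ℝ, 0 ≤ t → ∀ b : ℝ, ((F (ε + t, b) : ℝ) : ℂ) =
        ∫ p, cexp ((((-(t * p 0) : ℝ)) : ℂ) + ((b * p 1 : ℝ) : ℂ) * I) ∂μ)
    (hD : ∀ ε : ℝ, 0 < ε → ∃ μ : Measure (EuclideanSpace ℝ (Fin 4)), IsFiniteMeasure μ ∧
      μ {p | p 0 < 0} = 0 ∧ μ {p | p 0 < |p 1|} = 0 ∧
      ∀ u : ℝ, 0 ≤ u → ∀ v : ℝ, ((F ((ε + u + v) / Real.sqrt 2, (ε + u - v) / Real.sqrt 2) : ℝ) : ℂ) =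
        ∫ p, cexp ((((-(u * p 0) : ℝ)) : ℂ) + ((v * p 1 : ℝ) : ℂ) * I) ∂μ) :
    ∀ r φ : ℝ, 0 < r → F (r * Real.cos φ, r * Real.sin φ) = F (r, 0) := by
  sorry

/-- **Stub · the planar engine** (S; the v2 glue `planar_radial`, registered so that it lands as its
own file): a planar kernel (continuous off `0`, order `0 < σ < 8`, `D₄`) with axis Laplace–Fourier
representations of `F(ε + t, b)` and of the diagonal restriction `F((ε+u+v)/√2, (ε+u-v)/√2)` for every
`ε > 0` is radial — `stub_planarDiscSections` for `F` (fed by the diagonal representations) and for its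
light-cone transform `Φ = F ∘ L` (fed by the axis ones, `L` an involution), `stub_coneOfDiscSections`
for every measure, then `stub_planarAngularRigidity`. -/
theorem stub_planarRadial (F : ℝ × ℝ → ℝ) (σ : ℝ) (hσ : 0 < σ) (hσ8 : σ < 8)
    (hc : ContinuousOn F {x | x ≠ 0})
    (hb : ∃ C : ℝ, ∀ x : ℝ × ℝ, x ≠ 0 → |F x| ≤ C * (1 + (x.1 ^ 2 + x.2 ^ 2) ^ (-(σ / 2))))
    (hsym : ∀ t s : ℝ, F (t, s) = F (s, t) ∧ F (t, s) = F (t, -s) ∧ F (t, s) = F (-t, s))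
    (hA : ∀ ε : ℝ, 0 < ε → ∃ μ : Measure (EuclideanSpace ℝ (Fin 4)), IsFiniteMeasure μ ∧
      μ {p | p 0 < 0} = 0 ∧
      ∀ t : ℝ, 0 ≤ t → ∀ b : ℝ, ((F (ε + t, b) : ℝ) : ℂ) =
        ∫ p, cexp ((((-(t * p 0) : ℝ)) : ℂ) + ((b * p 1 : ℝ) : ℂ) * I) ∂μ)
    (hD : ∀ ε : ℝ, 0 < ε → ∃ μ : Measure (EuclideanSpace ℝ (Fin 4)), IsFiniteMeasure μ ∧
      μ {p | p 0 < 0} = 0 ∧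
      ∀ u : ℝ, 0 ≤ u → ∀ v : ℝ, ((F ((ε + u + v) / Real.sqrt 2, (ε + u - v) / Real.sqrt 2) : ℝ) : ℂ) =
        ∫ p, cexp ((((-(u * p 0) : ℝ)) : ℂ) + ((v * p 1 : ℝ) : ℂ) * I) ∂μ) :
    ∀ r φ : ℝ, 0 < r → F (r * Real.cos φ, r * Real.sin φ) = F (r, 0) := by
  sorry

/-! ## Glue I — the kernel's symmetries from `W(B₄)` (tree toolkit `IsSignedPermIsometry`) -/

section KernelSymm

variable {K : EuclideanSpace ℝ (Fin 4) → ℝ}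
  (hW : ∀ R : EuclideanSpace ℝ (Fin 4) ≃ₗᵢ[ℝ] EuclideanSpace ℝ (Fin 4), IsSignedPermIsometry R →
    ∀ x : EuclideanSpace ℝ (Fin 4), K (R x) = K x)
include hW

/-- Sign flips are in `W(B₄)`. -/
theorem K_mirror (k : Fin 4) (x : EuclideanSpace ℝ (Fin 4)) : K (mirrorReflection k x) = K x :=
  hW _ (isSignedPermIsometry_mirrorReflection k) x

/-- Transpositions are in `W(B₄)`. -/
theorem K_swapR (k l : Fin 4) (x : EuclideanSpace ℝ (Fin 4)) : K (swapReflection k l x) = K x :=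
  hW _ (isSignedPermIsometry_swapReflection k l) x

/-- Time reflection invariance, coordinate form. -/
theorem K_theta (x y : EuclideanSpace ℝ (Fin 4)) (h0 : y 0 = -x 0) (h1 : y 1 = x 1) (h2 : y 2 = x 2)
    (h3 : y 3 = x 3) : K y = K x := by
  have : y = mirrorReflection 0 x := by
    ext i; fin_cases i <;> simp [mirrorReflection_apply, h0, h1, h2, h3]
  rw [this, K_mirror hW]

/-- Spatial parity invariance, coordinate form. -/
theorem K_parity (x y : EuclideanSpace ℝ (Fin 4)) (h0 : y 0 = x 0) (h1 : y 1 = -x 1) (h2 : y 2 = -x 2)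
    (h3 : y 3 = -x 3) : K y = K x := by
  have : y = mirrorReflection 1 (mirrorReflection 2 (mirrorReflection 3 x)) := by
    ext i; fin_cases i <;> simp [mirrorReflection_apply, h0, h1, h2, h3]
  rw [this, K_mirror hW, K_mirror hW, K_mirror hW]

/-- Swap invariance, coordinate form. -/
theorem K_swap (x y : EuclideanSpace ℝ (Fin 4)) (h0 : y 0 = x 1) (h1 : y 1 = x 0) (h2 : y 2 = x 2)
    (h3 : y 3 = x 3) : K y = K x := by
  have : y = swapReflection 0 1 x := by
    ext i; fin_cases i <;> simp [swapReflection_apply, h0, h1, h2, h3, Equiv.swap_apply_def]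
  rw [this, K_swapR hW]

/-- `x₁ ↦ -x₁` invariance, coordinate form. -/
theorem K_neg1 (x y : EuclideanSpace ℝ (Fin 4)) (h0 : y 0 = x 0) (h1 : y 1 = -x 1) (h2 : y 2 = x 2)
    (h3 : y 3 = x 3) : K y = K x := by
  have : y = mirrorReflection 1 x := by
    ext i; fin_cases i <;> simp [mirrorReflection_apply, h0, h1, h2, h3]
  rw [this, K_mirror hW]

end KernelSymm

/-! ## Glue II — the light-cone involution `L₄` of `ℝ⁴` (written out) and the diagonal frame -/

/-- `((a + b)/√2)² + ((a - b)/√2)² = a² + b²`. -/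
theorem sq_div_sqrt_two_add (a b : ℝ) :
    ((a + b) / Real.sqrt 2) ^ 2 + ((a - b) / Real.sqrt 2) ^ 2 = a ^ 2 + b ^ 2 := by
  rw [div_pow, div_pow, Real.sq_sqrt two_pos.le]; ring

/-- `L₄` preserves the norm. -/
theorem norm_lc4 (x : EuclideanSpace ℝ (Fin 4)) :
    ‖(WithLp.toLp 2 ![(x 0 + x 1) / Real.sqrt 2, (x 0 - x 1) / Real.sqrt 2, x 2, x 3] :
        EuclideanSpace ℝ (Fin 4))‖ = ‖x‖ := by
  rw [EuclideanSpace.norm_eq, EuclideanSpace.norm_eq]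
  congr 1
  simp only [Fin.sum_univ_four, Real.norm_eq_abs, sq_abs]
  simp only [Fin.isValue, Matrix.cons_val_zero, Matrix.cons_val_one, Matrix.cons_val]
  linarith [sq_div_sqrt_two_add (x 0) (x 1)]

/-- `L₄ x ≠ 0` for `x ≠ 0`. -/
theorem lc4_ne_zero {x : EuclideanSpace ℝ (Fin 4)} (hx : x ≠ 0) :
    (WithLp.toLp 2 ![(x 0 + x 1) / Real.sqrt 2, (x 0 - x 1) / Real.sqrt 2, x 2, x 3] :
        EuclideanSpace ℝ (Fin 4)) ≠ 0 := by
  intro h0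
  apply hx
  have h1 : ‖x‖ = 0 := by rw [← norm_lc4 x, h0, norm_zero]
  exact norm_eq_zero.1 h1

/-- `L₄` is continuous. -/
theorem continuous_lc4 : Continuous fun x : EuclideanSpace ℝ (Fin 4) =>
    (WithLp.toLp 2 ![(x 0 + x 1) / Real.sqrt 2, (x 0 - x 1) / Real.sqrt 2, x 2, x 3] :
      EuclideanSpace ℝ (Fin 4)) := by
  refine (PiLp.continuous_toLp 2 _).comp (continuous_pi fun i => ?_)
  fin_cases i <;> simp <;> fun_prop

section Kernel45

variable {K : EuclideanSpace ℝ (Fin 4) → ℝ}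

/-- `K ∘ L₄` is continuous off `0`. -/
theorem kernel45_continuousOn (hc : ContinuousOn K {x | x ≠ 0}) :
    ContinuousOn (fun x : EuclideanSpace ℝ (Fin 4) =>
      K (WithLp.toLp 2 ![(x 0 + x 1) / Real.sqrt 2, (x 0 - x 1) / Real.sqrt 2, x 2, x 3]))
      {x : EuclideanSpace ℝ (Fin 4) | x ≠ 0} :=
  hc.comp continuous_lc4.continuousOn fun _ hx => lc4_ne_zero hx

/-- `K ∘ L₄` obeys the same bound. -/
theorem kernel45_bound {C q : ℝ}
    (hb : ∀ x : EuclideanSpace ℝ (Fin 4), x ≠ 0 → |K x| ≤ C * (1 + ‖x‖ ^ q)) :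
    ∀ x : EuclideanSpace ℝ (Fin 4), x ≠ 0 →
      |K (WithLp.toLp 2 ![(x 0 + x 1) / Real.sqrt 2, (x 0 - x 1) / Real.sqrt 2, x 2, x 3])| ≤
        C * (1 + ‖x‖ ^ q) := fun x hx => by
  simpa only [norm_lc4] using hb _ (lc4_ne_zero hx)

variable (hW : ∀ R : EuclideanSpace ℝ (Fin 4) ≃ₗᵢ[ℝ] EuclideanSpace ℝ (Fin 4), IsSignedPermIsometry R →
    ∀ x : EuclideanSpace ℝ (Fin 4), K (R x) = K x)
include hW

/-- Time reflection in the diagonal frame is `(x₀,x₁) ↦ (-x₁,-x₀)` upstairs. -/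
theorem kernel45_theta (x y : EuclideanSpace ℝ (Fin 4)) (h0 : y 0 = -x 0) (h1 : y 1 = x 1)
    (h2 : y 2 = x 2) (h3 : y 3 = x 3) :
    K (WithLp.toLp 2 ![(y 0 + y 1) / Real.sqrt 2, (y 0 - y 1) / Real.sqrt 2, y 2, y 3]) =
      K (WithLp.toLp 2 ![(x 0 + x 1) / Real.sqrt 2, (x 0 - x 1) / Real.sqrt 2, x 2, x 3]) := by
  have : (WithLp.toLp 2 ![(y 0 + y 1) / Real.sqrt 2, (y 0 - y 1) / Real.sqrt 2, y 2, y 3] :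
      EuclideanSpace ℝ (Fin 4)) = swapReflection 0 1 (mirrorReflection 0 (mirrorReflection 1
        (WithLp.toLp 2 ![(x 0 + x 1) / Real.sqrt 2, (x 0 - x 1) / Real.sqrt 2, x 2, x 3]))) := by
    ext i
    fin_cases i <;>
      (simp [swapReflection_apply, mirrorReflection_apply, Equiv.swap_apply_def, h0, h1, h2, h3]; try ring)
  rw [this, K_swapR hW, K_mirror hW, K_mirror hW]

/-- Spatial parity in the diagonal frame is `(x₀,x₁,x₂,x₃) ↦ (x₁,x₀,-x₂,-x₃)` upstairs. -/
theorem kernel45_parity (x y : EuclideanSpace ℝ (Fin 4)) (h0 : y 0 = x 0) (h1 : y 1 = -x 1)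
    (h2 : y 2 = -x 2) (h3 : y 3 = -x 3) :
    K (WithLp.toLp 2 ![(y 0 + y 1) / Real.sqrt 2, (y 0 - y 1) / Real.sqrt 2, y 2, y 3]) =
      K (WithLp.toLp 2 ![(x 0 + x 1) / Real.sqrt 2, (x 0 - x 1) / Real.sqrt 2, x 2, x 3]) := by
  have : (WithLp.toLp 2 ![(y 0 + y 1) / Real.sqrt 2, (y 0 - y 1) / Real.sqrt 2, y 2, y 3] :
      EuclideanSpace ℝ (Fin 4)) = swapReflection 0 1 (mirrorReflection 2 (mirrorReflection 3
        (WithLp.toLp 2 ![(x 0 + x 1) / Real.sqrt 2, (x 0 - x 1) / Real.sqrt 2, x 2, x 3]))) := by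
    ext i
    fin_cases i <;>
      (simp [swapReflection_apply, mirrorReflection_apply, Equiv.swap_apply_def, h0, h1, h2, h3]; try ring)
  rw [this, K_swapR hW, K_mirror hW, K_mirror hW]

/-- The swap in the diagonal frame is `x₁ ↦ -x₁` upstairs. -/
theorem kernel45_swap (x y : EuclideanSpace ℝ (Fin 4)) (h0 : y 0 = x 1) (h1 : y 1 = x 0)
    (h2 : y 2 = x 2) (h3 : y 3 = x 3) :
    K (WithLp.toLp 2 ![(y 0 + y 1) / Real.sqrt 2, (y 0 - y 1) / Real.sqrt 2, y 2, y 3]) =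
      K (WithLp.toLp 2 ![(x 0 + x 1) / Real.sqrt 2, (x 0 - x 1) / Real.sqrt 2, x 2, x 3]) := by
  have : (WithLp.toLp 2 ![(y 0 + y 1) / Real.sqrt 2, (y 0 - y 1) / Real.sqrt 2, y 2, y 3] :
      EuclideanSpace ℝ (Fin 4)) = mirrorReflection 1
        (WithLp.toLp 2 ![(x 0 + x 1) / Real.sqrt 2, (x 0 - x 1) / Real.sqrt 2, x 2, x 3]) := by
    ext i
    fin_cases i <;> (simp [mirrorReflection_apply, h0, h1, h2, h3]; try ring)
  rw [this, K_mirror hW]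

/-- `x₁ ↦ -x₁` in the diagonal frame is the swap upstairs. -/
theorem kernel45_neg1 (x y : EuclideanSpace ℝ (Fin 4)) (h0 : y 0 = x 0) (h1 : y 1 = -x 1)
    (h2 : y 2 = x 2) (h3 : y 3 = x 3) :
    K (WithLp.toLp 2 ![(y 0 + y 1) / Real.sqrt 2, (y 0 - y 1) / Real.sqrt 2, y 2, y 3]) =
      K (WithLp.toLp 2 ![(x 0 + x 1) / Real.sqrt 2, (x 0 - x 1) / Real.sqrt 2, x 2, x 3]) := by
  have : (WithLp.toLp 2 ![(y 0 + y 1) / Real.sqrt 2, (y 0 - y 1) / Real.sqrt 2, y 2, y 3] :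
      EuclideanSpace ℝ (Fin 4)) = swapReflection 0 1
        (WithLp.toLp 2 ![(x 0 + x 1) / Real.sqrt 2, (x 0 - x 1) / Real.sqrt 2, x 2, x 3]) := by
    ext i
    fin_cases i <;> (simp [swapReflection_apply, Equiv.swap_apply_def, h0, h1, h2, h3]; try ring)
  rw [this, K_swapR hW]

/-- **The crux's diagonal clause is the axis clause of `K ∘ L₄`.** With `Y_i = σ₁ (L₄ x_i)`
(`σ₁ = mirrorReflection 1`): `L₄ (θ x_i - x_j) = σ₁ (swap₀₁ Y_i - Y_j)` and `Y_i 1 < Y_i 0 ⟺ 0 < x_i 0`. -/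
theorem kernel45_axisRP
    (hdg : ∀ (m : ℕ) (x : Fin m → EuclideanSpace ℝ (Fin 4)) (c : Fin m → ℝ), (∀ i, x i 1 < x i 0) →
      0 ≤ ∑ i, ∑ j, c i * c j *
        K (LinearIsometryEquiv.piLpCongrLeft 2 ℝ ℝ (Equiv.swap (0 : Fin 4) 1) (x i) - x j)) :
    ∀ (m : ℕ) (x : Fin m → EuclideanSpace ℝ (Fin 4)) (c : Fin m → ℝ), (∀ i, 0 < x i 0) →
      0 ≤ ∑ i, ∑ j, c i * c j *
        K (WithLp.toLp 2 ![((timeReflection 4 (x i) - x j) 0 + (timeReflection 4 (x i) - x j) 1) /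
          Real.sqrt 2, ((timeReflection 4 (x i) - x j) 0 - (timeReflection 4 (x i) - x j) 1) /
          Real.sqrt 2, (timeReflection 4 (x i) - x j) 2, (timeReflection 4 (x i) - x j) 3]) := by
  intro m x c hx
  have hs : 0 < Real.sqrt 2 := Real.sqrt_pos.2 two_pos
  set Y : Fin m → EuclideanSpace ℝ (Fin 4) := fun i => mirrorReflection 1
    (WithLp.toLp 2 ![(x i 0 + x i 1) / Real.sqrt 2, (x i 0 - x i 1) / Real.sqrt 2, x i 2, x i 3])
    with hY
  have hY' : ∀ i, Y i 1 < Y i 0 := by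
    intro i
    simp only [hY, mirrorReflection_apply]
    simp only [Fin.isValue, ↓reduceIte, Matrix.cons_val_one, Matrix.cons_val_zero]
    have h1 : -((x i 0 - x i 1) / Real.sqrt 2) = (x i 1 - x i 0) / Real.sqrt 2 := by ring
    rw [h1]
    exact div_lt_div_of_pos_right (by linarith [hx i]) hs
  refine (hdg m Y c hY').trans_eq (Finset.sum_congr rfl fun i _ => Finset.sum_congr rfl fun j _ => ?_)
  congr 1
  have hvec : (WithLp.toLp 2 ![((timeReflection 4 (x i) - x j) 0 + (timeReflection 4 (x i) - x j) 1) /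
          Real.sqrt 2, ((timeReflection 4 (x i) - x j) 0 - (timeReflection 4 (x i) - x j) 1) /
          Real.sqrt 2, (timeReflection 4 (x i) - x j) 2, (timeReflection 4 (x i) - x j) 3] :
        EuclideanSpace ℝ (Fin 4)) =
      mirrorReflection 1 (LinearIsometryEquiv.piLpCongrLeft 2 ℝ ℝ (Equiv.swap (0 : Fin 4) 1) (Y i) - Y j) := by
    ext k
    fin_cases k <;>
      (simp [hY, mirrorReflection_apply, timeReflection_apply, LinearIsometryEquiv.piLpCongrLeft_apply,
        Equiv.piCongrLeft'_apply, Equiv.symm_swap, Equiv.swap_apply_def]; try ring)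
  rw [hvec, K_mirror hW]

end Kernel45

/-! ## Glue III — planar bookkeeping -/

/-- **Smearing commutes with the light-cone involutions**: `smear (K ∘ L₄) h (a,b) = smear K h (L(a,b))`. -/
theorem smear_lc4 (K : EuclideanSpace ℝ (Fin 4) → ℝ) (h : ℝ × ℝ → ℝ) (x : ℝ × ℝ) :
    (∫ y : ℝ × ℝ, ∫ y' : ℝ × ℝ, h y * h y' *
      (fun w : EuclideanSpace ℝ (Fin 4) =>
        K (WithLp.toLp 2 ![(w 0 + w 1) / Real.sqrt 2, (w 0 - w 1) / Real.sqrt 2, w 2, w 3]))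
        (WithLp.toLp 2 ![x.1, x.2, (y - y').1, (y - y').2])) =
    ∫ y : ℝ × ℝ, ∫ y' : ℝ × ℝ, h y * h y' *
      K (WithLp.toLp 2 ![((x.1 + x.2) / Real.sqrt 2, (x.1 - x.2) / Real.sqrt 2).1,
        ((x.1 + x.2) / Real.sqrt 2, (x.1 - x.2) / Real.sqrt 2).2, (y - y').1, (y - y').2]) := by
  simp

/-- Polar coordinates in `ℝ × ℝ` (planner's glue, kept). -/
theorem exists_polar (x : ℝ × ℝ) (hx : x ≠ 0) :
    0 < Real.sqrt (x.1 ^ 2 + x.2 ^ 2) ∧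
      ∃ φ : ℝ, x = (Real.sqrt (x.1 ^ 2 + x.2 ^ 2) * Real.cos φ, Real.sqrt (x.1 ^ 2 + x.2 ^ 2) * Real.sin φ) := by
  set z : ℂ := ⟨x.1, x.2⟩ with hz
  have hz0 : z ≠ 0 := by
    intro h
    apply hx
    have h1 : x.1 = 0 := by simpa [hz] using congrArg Complex.re h
    have h2 : x.2 = 0 := by simpa [hz] using congrArg Complex.im h
    exact Prod.ext h1 h2
  have hnorm : ‖z‖ = Real.sqrt (x.1 ^ 2 + x.2 ^ 2) := by
    rw [Complex.norm_def, Complex.normSq_apply]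
    simp [hz, sq]
  have hpos : 0 < ‖z‖ := norm_pos_iff.mpr hz0
  refine ⟨hnorm ▸ hpos, Complex.arg z, ?_⟩
  have hc := Complex.cos_arg hz0
  have hs := Complex.sin_arg z
  have hne : ‖z‖ ≠ 0 := hpos.ne'
  rw [← hnorm, hc, hs]
  refine Prod.ext ?_ ?_
  · simp only []
    field_simp
    simp [hz]
  · simp only []
    field_simp
    simp [hz]

/-! ## The composition -/

/-- **The skeleton closes the crux BY NAME modulo exactly the registered stubs.** Fix `K` with the
crux hypotheses for some `η > 0`; `stub_exponentReduction` trades the exponent for `η' = min η 7 ∈ (0, 8)`;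
`stub_axisLaplace` represents `K` and `K ∘ L₄` along the time axis (boundedness away from `x₀ = 0` from
the bound; the symmetries and the axis clause of `K ∘ L₄` from `W(B₄)` and the diagonal clause);
`stub_smearTransport` moves both to every transverse autocorrelation smearing `F_h` (order `8 - η' < 8`,
`D₄`, axis and diagonal representations, the latter through `smear_lc4`); `stub_planarRadial` makes
`F_h` radial; `stub_radialLift` lifts radial smears to invariance of `K` under every linear isometry. -/
theorem ShellRigidity_proof : Summit.QuantumFields.YangMills.Theses.PencilRigidity.ShellRigidity := by
  intro K hcont hbd hW hax hdg R x _hx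
  change ∀ R : EuclideanSpace ℝ (Fin 4) ≃ₗᵢ[ℝ] EuclideanSpace ℝ (Fin 4), IsSignedPermIsometry R →
    ∀ x : EuclideanSpace ℝ (Fin 4), K (R x) = K x at hW
  obtain ⟨C, η, hη, hb⟩ := hbd
  -- exponent `η' = min η 7 ∈ (0, 8)`
  obtain ⟨C', hb'⟩ := stub_exponentReduction K η hη hcont ⟨C, hb⟩ hW hax
  set η' := min η 7 with hη'def
  have hη' : 0 < η' := lt_min hη (by norm_num)
  have h8 : η' < 8 := lt_of_le_of_lt (min_le_right η 7) (by norm_num)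
  have hσ : 0 < 8 - η' := by linarith
  have hσ8 : 8 - η' < 8 := by linarith
  -- boundedness away from the time-zero hyperplane, for `K` and for `K ∘ L₄`
  have hbdd_of : ∀ K₁ : EuclideanSpace ℝ (Fin 4) → ℝ,
      (∀ x : EuclideanSpace ℝ (Fin 4), x ≠ 0 → |K₁ x| ≤ C' * (1 + ‖x‖ ^ (η' - 10))) →
      ∀ ε : ℝ, 0 < ε → ∃ B : ℝ, ∀ x : EuclideanSpace ℝ (Fin 4), ε ≤ |x 0| → |K₁ x| ≤ B := by
    intro K₁ hK₁ ε hε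
    refine ⟨|C'| * (1 + ε ^ (η' - 10)), fun x hx0 => ?_⟩
    have hxn : ε ≤ ‖x‖ :=
      hx0.trans ((Real.norm_eq_abs _).symm.le.trans (PiLp.norm_apply_le x 0))
    have hx : x ≠ 0 := by
      intro h0; rw [h0, norm_zero] at hxn; linarith
    have hq : ‖x‖ ^ (η' - 10) ≤ ε ^ (η' - 10) :=
      Real.rpow_le_rpow_of_nonpos hε hxn (by linarith)
    have h0 : (0 : ℝ) ≤ 1 + ‖x‖ ^ (η' - 10) := by positivity
    calc |K₁ x| ≤ C' * (1 + ‖x‖ ^ (η' - 10)) := hK₁ x hx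
      _ ≤ |C'| * (1 + ‖x‖ ^ (η' - 10)) := mul_le_mul_of_nonneg_right (le_abs_self C') h0
      _ ≤ |C'| * (1 + ε ^ (η' - 10)) := mul_le_mul_of_nonneg_left (by linarith) (abs_nonneg C')
  -- Laplace–Fourier representations along the time axis, in the axis frame and the diagonal frame
  have hrepK := stub_axisLaplace K hcont (hbdd_of K hb') (K_theta hW) (K_parity hW) hax
  have hrepK45 := stub_axisLaplace
    (fun x => K (WithLp.toLp 2 ![(x 0 + x 1) / Real.sqrt 2, (x 0 - x 1) / Real.sqrt 2, x 2, x 3]))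
    (kernel45_continuousOn hcont) (hbdd_of _ (kernel45_bound hb')) (kernel45_theta hW)
    (kernel45_parity hW) (kernel45_axisRP hW hdg)
  -- radiality of every smeared kernel, in equal-radius form
  have hsm : ∀ h : ℝ × ℝ → ℝ, Continuous h → HasCompactSupport h →
      ∀ x y : ℝ × ℝ, x ≠ 0 → x.1 ^ 2 + x.2 ^ 2 = y.1 ^ 2 + y.2 ^ 2 →
        (∫ w : ℝ × ℝ, ∫ w' : ℝ × ℝ,
            h w * h w' * K (WithLp.toLp 2 ![x.1, x.2, (w - w').1, (w - w').2])) =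
          ∫ w : ℝ × ℝ, ∫ w' : ℝ × ℝ,
            h w * h w' * K (WithLp.toLp 2 ![y.1, y.2, (w - w').1, (w - w').2]) := by
    intro h hhc hhs x y hx hxy
    set F : ℝ × ℝ → ℝ := fun x => ∫ w : ℝ × ℝ, ∫ w' : ℝ × ℝ,
      h w * h w' * K (WithLp.toLp 2 ![x.1, x.2, (w - w').1, (w - w').2]) with hFdef
    obtain ⟨hFc, hFb, hFsym, hFrep⟩ := stub_smearTransport K η' hη' h8 hcont ⟨C', hb'⟩ (K_swap hW)
      (K_neg1 hW) (K_theta hW) hrepK h hhc hhs F (fun _ => rfl)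
    obtain ⟨-, -, -, hF45rep⟩ := stub_smearTransport
      (fun x => K (WithLp.toLp 2 ![(x 0 + x 1) / Real.sqrt 2, (x 0 - x 1) / Real.sqrt 2, x 2, x 3]))
      η' hη' h8 (kernel45_continuousOn hcont) ⟨C', kernel45_bound hb'⟩ (kernel45_swap hW)
      (kernel45_neg1 hW) (kernel45_theta hW) hrepK45 h hhc hhs
      (fun x => F ((x.1 + x.2) / Real.sqrt 2, (x.1 - x.2) / Real.sqrt 2))
      (fun x => by rw [hFdef, smear_lc4])
    have hrad := stub_planarRadial F (8 - η') hσ hσ8 hFc hFb hFsym hFrep hF45rep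
    obtain ⟨hrx, φ, hφ⟩ := exists_polar x hx
    have hy : y ≠ 0 := by
      intro hy0
      rw [hy0] at hxy
      simp only [Prod.fst_zero, Prod.snd_zero] at hxy
      have : Real.sqrt (x.1 ^ 2 + x.2 ^ 2) = 0 := by rw [hxy]; simp
      linarith
    obtain ⟨hry, ψ, hψ⟩ := exists_polar y hy
    show F x = F y
    rw [hφ, hψ, hrad _ _ hrx, hrad _ _ hry, hxy]
  exact stub_radialLift K hcont hW hsm R x

end Summit.QuantumFields.YangMills.Cruxes.ShellRigidity.TransverseSmearingPlanarThreshold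

end
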